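import Literature.Geometry.Lorentzian.CoordCurvatureLaplacian
import Literature.Geometry.Lorentzian.CoordRicciEvolution
import HarnessLib

/-!
# Evolution of the curvature tensor under the Ricci flow, in coordinates (Topping, Prop. 2.5.1)

Seventh layer of the coordinate tensor calculus. For a smooth one-parameter family of metric
components `G : ℝ → E → (E →L E →L ℝ)` on `V × S` (`IsMetricFamilyOn G S V`,
`CoordMetricVariation.lean`) solving the **Ricci flow in coordinates** `∂G/∂t = −2 Ric(G)` on
`V × S`, we prove **Topping 2006, Prop. 2.5.1** (Hamilton 1982, Thm. 7.1): the curvature tensor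
evolves by a heat equation,

  `∂_t G(R(X,Y)Z, W) = G((ΔR)(X,Y)Z, W) + Q(X,Y,Z,W) − Q(Y,X,Z,W) − Ric(R(X,Y)Z, W) + Ric(Z, R(X,Y)W)`

(`IsMetricFamilyOn.hasDerivWithinAt_apply_riemAt_ricciFlow`; derivative within `S`, valid up
to the end points), where `ΔR = lapRiemAt` is the rough Laplacian of the curvature endomorphism
and `Q = quadRiemAt` the quadratic expression of `CoordCurvatureLaplacian.lean` — i.e.
`∂_t Rm = ΔRm + Rm * Rm` (Topping, Remark 2.5.2, (2.5.2)), with the quadratic terms explicit in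
the tree's conventions (our `R(X,Y)` is Topping's `−R(X,Y)`).

The proof is the printed one (Prop. 2.3.5 with `h = −2 Ric`, simplified by Prop. 2.4.1):

* `IsMetricFamilyOn.apply_varRiemAt_eq_cov₃At` — with `π(A,B,C) = G(Π(A,B), C)`
  (`piForm`, `CoordRicciEvolution.lean`), `Π = ∂Γ/∂t` (`varChrAt`), the first variation of the
  curvature (Prop. 2.3.4, `hasDerivWithinAt_riemAt`) lowered with the metric is
  `G(∂_t R(X,Y)Z, W) = (∇_X π)(Y,Z,W) − (∇_Y π)(X,Z,W)` (Topping, proof of Prop. 2.3.5: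
  `⟨(∇_YΠ)(X,W),Z⟩ = Y⟨Π(X,W),Z⟩ = …`; lowering commutes with `∇`, `apply_cov_varChrAt`);
* under the flow `(∇_X π)(A,B,C) = −[(∇²_{X,A}Ric)(B,C) + (∇²_{X,B}Ric)(A,C) − (∇²_{X,C}Ric)(A,B)]`
  (`IsMetricFamilyOn.cov₃At_piForm` of `CoordRicciEvolution.lean`, Prop. 2.3.1 with `h = −2Ric`);
* `apply_varRiemAt_of_flow` — comparing with Prop. 2.4.1 (`apply_lapRiemAt`) through the Ricci
  identity for `Ric` (`cov₃At_cov₂At_comm`) and the symmetry of `∇²Ric`: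
  `G(∂_t R(X,Y)Z, W) = G((ΔR)(X,Y)Z, W) + Q(X,Y,Z,W) − Q(Y,X,Z,W) + Ric(R(X,Y)Z,W) + Ric(Z,R(X,Y)W)`;
* finally `∂_t G(R Z, W) = h(R Z, W) + G(∂_t R Z, W)` with `h = −2 Ric`.

Everything is proved; no definition is introduced.

## References

* P. Topping, *Lectures on the Ricci flow*, LMS Lecture Note Series 325, CUP 2006: Prop. 2.3.1,
  2.3.4, 2.3.5 (and its proof, p. 27), Prop. 2.4.1, §2.5, Prop. 2.5.1 and Remark 2.5.2 (p. 33).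
  [Topping2006]
* R. S. Hamilton, *Three-manifolds with positive Ricci curvature*, J. Differential Geom. 17
  (1982), §7, Thm. 7.1, Lemma 7.2. [Hamilton1982]
-/

noncomputable section

set_option maxSynthPendingDepth 3

open Set Filter ContinuousLinearMap Module
open scoped Topology ContDiff

namespace Literature.Geometry.Lorentzian

namespace MetricCoord

variable {E : Type*} [NormedAddCommGroup E] [NormedSpace ℝ E]

/-! ### The first variation of the curvature, lowered -/

section Lowered

variable [CompleteSpace E] {G : ℝ → E → E →L[ℝ] E →L[ℝ] ℝ} {S : Set ℝ} {V : Set E} {x : E} {t : ℝ}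

/-- **The first variation of the curvature, lowered, is the antisymmetrised covariant derivative
of `π`** (Topping 2006, Prop. 2.3.5, first display of its proof, in the tree's sign convention):
`G(∂_t R(X,Y) Z, W) = (∇_X π)(Y,Z,W) − (∇_Y π)(X,Z,W)`, with `∂_t R(X,Y) = varRiemAt` and
`π = piForm` (`G(Π(A,B),C)`; lowering commutes with `∇`, `apply_cov_varChrAt`).
[cite: Topping2006, Prop. 2.3.5 (proof)] -/
theorem IsMetricFamilyOn.apply_varRiemAt_eq_cov₃At (hG : IsMetricFamilyOn G S V) (hx : x ∈ V)
    (ht : t ∈ S) (X Y Z W : E) :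
    G t x (varRiemAt G S t x X Y Z) W =
      cov₃At (G t) (piForm G S t) x X Y Z W - cov₃At (G t) (piForm G S t) x Y X Z W := by
  have hGt := hG.isMetricOn t ht
  rw [← hG.apply_cov_varChrAt hx ht X Y Z W, ← hG.apply_cov_varChrAt hx ht Y X Z W, varRiemAt_apply,
    hGt.chrAt_comm hx Y X]
  simp only [map_add, map_sub, _root_.add_apply, _root_.sub_apply]
  ring

end Lowered

/-! ### Under the Ricci flow: Prop. 2.5.1 -/

namespace IsMetricFamilyOn

section RicciFlow

variable {ι : Type*} [Fintype ι] [FiniteDimensional ℝ E] [CompleteSpace E]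
  {G : ℝ → E → E →L[ℝ] E →L[ℝ] ℝ} {S : Set ℝ} {V : Set E} {x : E} {t : ℝ} (b : Basis ι ℝ E)
  (hG : IsMetricFamilyOn G S V)
  (hfl : ∀ s ∈ S, ∀ y ∈ V, tDeriv G S s y = (-2 : ℝ) • ricAt (G s) y)
include hG hfl

/-- **Topping 2006, Prop. 2.5.1 for the curvature endomorphism, lowered** (the first variation
of the curvature under `h = −2Ric`, compared with the Laplacian formula of Prop. 2.4.1): in any
basis `b`,
`G(∂_t R(X,Y)Z, W) = G((ΔR)(X,Y)Z, W) + Q(X,Y,Z,W) − Q(Y,X,Z,W) + Ric(R(X,Y)Z, W) + Ric(Z, R(X,Y)W)`,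
with `∂_t R = varRiemAt`, `ΔR = lapRiemAt`, `Q = quadRiemAt`. From `apply_varRiemAt_eq_cov₃At`,
`cov₃At_piForm` (`CoordRicciEvolution.lean`), the Ricci identity `cov₃At_cov₂At_comm` for `Ric`,
the symmetry of `∇²Ric` and `apply_lapRiemAt`. [cite: Topping2006, Prop. 2.5.1] -/
theorem apply_varRiemAt_of_flow (hx : x ∈ V) (ht : t ∈ S) (X Y Z W : E) :
    G t x (varRiemAt G S t x X Y Z) W =
      G t x (lapRiemAt (G t) b x X Y Z) W
        + quadRiemAt (G t) b x X Y Z W - quadRiemAt (G t) b x Y X Z W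
        + ricAt (G t) x (riemAt (G t) x X Y Z) W + ricAt (G t) x Z (riemAt (G t) x X Y W) := by
  have hGt := hG.isMetricOn t ht
  have hRic := hGt.cov₃At_cov₂At_comm hx (hGt.contDiffAt_ricAt hx) X Y Z W
  have hs := hGt.cov₃At_cov₂At_ricAt_symm hx
  rw [hG.apply_varRiemAt_eq_cov₃At hx ht, hG.cov₃At_piForm hfl hx ht,
    hG.cov₃At_piForm hfl hx ht, hGt.apply_lapRiemAt b hx,
    hs X Z Y W, hs X W Y Z, hs Y Z X W, hs Y W X Z]
  linarith

/-- **Topping 2006, Prop. 2.5.1 (evolution of the curvature tensor under the Ricci flow), in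
coordinates.** Along a smooth family of metric components solving `∂G/∂t = −2 Ric(G)` on
`V × S`, at `t ∈ S`, `x ∈ V`, for constant fields `X, Y, Z, W` and any basis `b`:
`∂_t G(R(X,Y)Z, W) = G((ΔR)(X,Y)Z, W) + Q(X,Y,Z,W) − Q(Y,X,Z,W) − Ric(R(X,Y)Z, W) + Ric(Z, R(X,Y)W)`
within `S` (so up to the end points of a closed time interval) — "`∂_t Rm = ΔRm + Rm * Rm`"
(Remark 2.5.2), with `ΔR = lapRiemAt`, `Q = quadRiemAt`; the last two terms are
`h(R(X,Y)Z, W) = −2Ric(R(X,Y)Z, W)` plus the `Ric ∘ R` terms of `apply_varRiemAt_of_flow`.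
[cite: Topping2006, Prop. 2.5.1] -/
theorem hasDerivWithinAt_apply_riemAt_ricciFlow (hx : x ∈ V) (ht : t ∈ S) (X Y Z W : E) :
    HasDerivWithinAt (fun s ↦ G s x (riemAt (G s) x X Y Z) W)
      (G t x (lapRiemAt (G t) b x X Y Z) W
        + quadRiemAt (G t) b x X Y Z W - quadRiemAt (G t) b x Y X Z W
        - ricAt (G t) x (riemAt (G t) x X Y Z) W + ricAt (G t) x Z (riemAt (G t) x X Y W)) S t := by
  have hGx := hG.hasDerivWithinAt hx ht
  have hR := hG.hasDerivWithinAt_riemAt_apply hx ht X Y Z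
  have h1 := (hGx.clm_apply hR).clm_apply (hasDerivWithinAt_const t S W)
  simp only [map_zero, add_zero] at h1
  refine h1.congr_deriv ?_
  rw [_root_.add_apply, hG.apply_varRiemAt_of_flow b hfl hx ht, hfl t ht x hx,
    _root_.smul_apply, _root_.smul_apply, smul_eq_mul]
  ring

end RicciFlow

end IsMetricFamilyOn

end MetricCoord

end Literature.Geometry.Lorentzian

end
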